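import Mathlib
import Summits.NavierStokesRegularity.NavierStokesRegularity.Theorems.BarrierStepRungThreeDefs
import Summits.NavierStokesRegularity.NavierStokesRegularity.Theorems.BarrierStepRungThreeTriggerWindowField5
import HarnessLib

/-!
# `BarrierStepRungThree`, LINE g2-2 (admissible windows): GENERAL dynamic-clause adapter for the
two-function certificate (tube `h`, clock `w`, collar clock `w + C·h²`), with the route definitions

For the windows `kLo = −1, n = 5` and `kLo = −2, n = 6` (definitions `TriggerWindow.point5/field5`,
`point6/field6` of `Theorems/BarrierStepRungThreeDefs.lean`), `lie_box_of_sos₅/₆`... (names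
`lie_box_of_sos5/6`) turn an `sdp2lean`-shaped fact “`(lieDeriv (field β) D)(y) ≤ m` for all points
`y` of a semialgebraic box described by an arbitrary premise `Prem` plus the window/boundary caps”
into the lattice statement “for every state `S` with `Prem (point S)` and the caps, the derivative of
`x ↦ D.eval (L x)` at the window state along the pencil's `quadTerm` is `≤ m`” — for ANY
differentiated polynomial `D`. With `D := w` and `Prem :=` (`w ≤ 0`, `h ≤ 0`, `g > 0`) this is
`hdec_in`; with the collar premises it is `hdec_col`; with `D := h` it is `hinflow` of
`WindowBox.taoLadderRungThree_target_of_twoFunctionCertificate₃`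
(Theorems/BarrierStepRungThreeWindowTwoFunction.lean); `eval_window_eq_eval_point5/6` moves
premises between the window coordinates `L (win S)` and `point S`. Also the reading lemmas of
`point5/point6`.

HONEST FRAMING: plumbing for the certificate instance of a line on class rung TL-M3 (MODEL lattice
table); proves no certificate, closes no item, says nothing about the Navier–Stokes equations.
-/

noncomputable section

-- the sub-problem namespace `Summit.NavierStokesRegularity.NavierStokesRegularity` repeats the summit name by design (D-0017)
set_option linter.dupNamespace false

namespace Summit.NavierStokesRegularity.NavierStokesRegularity.Theorems

namespace TriggerWindow

open Finset
open Literature.Analysis.FluidPDE Literature.Analysis.FluidPDE.TaoCascade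
open Literature.Computation.Certificates Literature.Computation.Certificates.SOS
open Literature.Computation.Certificates.SOS.Poly

/-! ### Window `kLo = -1`, `n = 5` with the route definitions `point5` / `field5` -/

/-- `point5 S` reads the window at `4j+i`. [this file] -/
theorem point5_window (S : Fin 4 → ℤ → ℝ) (i : Fin 4) (j : Fin 5) :
    point5 S (4 * (j : ℕ) + (i : ℕ)) = S i ((-1 : ℤ) + (j : ℕ)) := by
  fin_cases i <;> fin_cases j <;> rfl

/-- `point5 S` reads the boundary shell `-2` at `20+i`. [this file] -/
theorem point5_below (S : Fin 4 → ℤ → ℝ) (i : Fin 4) : point5 S (20 + (i : ℕ)) = S i (-2) := by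
  fin_cases i <;> rfl

/-- `point5 S` reads the boundary shell `4` at `24+i`. [this file] -/
theorem point5_above (S : Fin 4 → ℤ → ℝ) (i : Fin 4) : point5 S (24 + (i : ℕ)) = S i (4) := by
  fin_cases i <;> rfl

/-- `point5 S 28 = √2`. [this file] -/
theorem point5_sqrt (S : Fin 4 → ℤ → ℝ) : point5 S 28 = Real.sqrt 2 := rfl

/-- **Window/point agreement**: a polynomial in the window variables (`numVars ≤ 20`) has the same value
at the window coordinates `L (win S)` and at `point5 S`. [folklore] -/
theorem eval_window_eq_eval_point5 (Q : Poly) (hQ : numVars Q ≤ 20)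
    (L : (Fin 4 → Fin 5 → ℝ) →L[ℝ] (ℕ → ℝ))
    (hL : ∀ (x : Fin 4 → Fin 5 → ℝ) (i : Fin 4) (j : Fin 5), L x (4 * (j : ℕ) + (i : ℕ)) = x i j)
    (S : Fin 4 → ℤ → ℝ) :
    (Poly.eval (L (fun i (j : Fin 5) => S i ((-1 : ℤ) + ((j : ℕ) : ℤ)))) Q : ℝ) = Poly.eval (point5 S) Q := by
  refine eval_congr Q fun k hk => ?_
  obtain ⟨i, j, rfl⟩ := exists_window_index₅ k (lt_of_lt_of_le hk hQ)
  rw [hL, point5_window]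

section Pencil5

variable (τ α₀ τ' σ : Fin 4 → Fin 4 → Fin 4 → ℤ × ℤ × ℤ → ℝ)
  (hτ : τ = fun (a b c : Fin 4) (μ : ℤ × ℤ × ℤ) => if a = 0 ∧ b = 1 ∧ c = 1 then
    (if μ = (0, 0, 0) then (1 : ℝ) / 2 else if μ = (1, 0, 0) then -(1 / 2) else 0) else 0)
  (hα₀ : α₀ = fun (a b c : Fin 4) (μ : ℤ × ℤ × ℤ) => τ a b c μ - τ c b a (μ.2.2, μ.2.1, μ.1) +
    τ b a c (μ.2.1, μ.1, μ.2.2) - τ c a b (μ.2.2, μ.1, μ.2.1))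
  (hτ' : τ' = fun (a b c : Fin 4) (μ : ℤ × ℤ × ℤ) => if a = 0 ∧ b = 1 ∧ c = 1 then
    (if μ = (0, 0, 1) then (1 : ℝ) / 2 else 0) else 0)
  (hσ : σ = fun (a b c : Fin 4) (μ : ℤ × ℤ × ℤ) => τ' a b c μ - τ' c b a (μ.2.2, μ.2.1, μ.1) +
    τ' b a c (μ.2.1, μ.1, μ.2.2) - τ' c a b (μ.2.2, μ.1, μ.2.1))

include hτ hα₀ hτ' hσ

/-- **General dynamic-clause adapter (window `kLo = -1`, `n = 5`).** For ANY sparse rational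
polynomial `D` in the window variables (the clock `w`, the tube `h`, the collar clock `w + C·h²`, …)
and ANY premise `Prem` on evaluation points: if `(lieDeriv (field5 β) D)(y) ≤ m` holds at every
point `y` with `y_28² = 2`, `y_28 ≥ 0`, `Prem y`, the window caps and the boundary caps — the shape
of an `sdp2lean` certificate whose side conditions encode `Prem` — then for every lattice state `S`
whose point satisfies `Prem` and whose coordinates obey the caps, the Fréchet derivative of
`x ↦ D.eval (L x)` at the window state, applied to the window restriction of the pencil's
`quadTerm`, is `≤ m`. Specialises to `hdec_in`, `hdec_col`, `hinflow` of
`WindowBox.taoLadderRungThree_target_of_twoFunctionCertificate₃` (move premises between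
`L (win S)` and `point5 S` with `eval_window_eq_eval_point5`).
[cite: RoucheHabetsLaloy1977, Ch. I §3.1 eq. (3.1); Tao2016AveragedNS §4 (4.8)] -/
theorem lie_box_of_sos5 (β : ℚ) (D : Poly) (hD : numVars D ≤ 20) (Prem : (ℕ → ℝ) → Prop)
    (L : (Fin 4 → Fin 5 → ℝ) →L[ℝ] (ℕ → ℝ))
    (hL : ∀ (x : Fin 4 → Fin 5 → ℝ) (i : Fin 4) (j : Fin 5), L x (4 * (j : ℕ) + (i : ℕ)) = x i j)
    {q : ℤ → ℝ} {Φ : Fin 4 → Fin 5 → ℝ} {m : ℝ}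
    (hsos : ∀ y : ℕ → ℝ, y 28 * y 28 = 2 → 0 ≤ y 28 → Prem y →
      (∀ (i : Fin 4) (j : Fin 5), y (4 * (j : ℕ) + (i : ℕ)) ^ 2 ≤ 2 * Φ i j) →
      (∀ i : Fin 4, |y (20 + (i : ℕ))| ≤ q (-2)) → (∀ i : Fin 4, |y (24 + (i : ℕ))| ≤ q (4)) →
      (Poly.eval y (lieDeriv (field5 β) D) : ℝ) ≤ m) :
    ∀ S : Fin 4 → ℤ → ℝ, Prem (point5 S) →
      (∀ (i : Fin 4) (k : ℤ), (k < (-1 : ℤ) ∨ (-1 : ℤ) + ((5 : ℕ) : ℤ) ≤ k) → |S i k| ≤ q k) →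
      (∀ (i : Fin 4) (j : Fin 5), S i ((-1 : ℤ) + ((j : ℕ) : ℤ)) ^ 2 ≤ 2 * Φ i j) →
      (fderiv ℝ (fun x : Fin 4 → Fin 5 → ℝ => (Poly.eval (L x) D : ℝ)) (fun i (j : Fin 5) => S i ((-1 : ℤ) + ((j : ℕ) : ℤ))))
        (fun i (j : Fin 5) => quadTerm 1 (fun a b c μ => α₀ a b c μ + (β : ℝ) * σ a b c μ)
          (fun i' k' (_ : ℝ) => S i' k') i ((-1 : ℤ) + ((j : ℕ) : ℤ)) 0) ≤ m := by
  intro S hPrem hout hcap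
  have hy : ∀ k < 20, L (fun i (j : Fin 5) => S i ((-1 : ℤ) + ((j : ℕ) : ℤ))) k = point5 S k := by
    intro k hk
    obtain ⟨i, j, rfl⟩ := exists_window_index₅ k hk
    rw [hL, point5_window]
  have key := hsos (point5 S) (by rw [point5_sqrt]; exact Real.mul_self_sqrt zero_le_two)
    (by rw [point5_sqrt]; exact Real.sqrt_nonneg 2) hPrem
    (fun i j => by rw [point5_window]; exact hcap i j)
    (fun i => by rw [point5_below]; exact hout i (-2) (Or.inl (by norm_num)))
    (fun i => by rw [point5_above]; exact hout i (4) (Or.inr (by norm_num)))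
  rw [eval_lieDeriv] at key
  rw [SOSPolyCalculus.fderiv_eval_comp_apply]
  refine le_of_eq_of_le (Finset.sum_congr rfl fun k hk => ?_) key
  have hk : k < numVars D := by simpa using hk
  have hkW : k < 20 := lt_of_lt_of_le hk hD
  congr 1
  · exact eval_congr _ fun k' hk' => hy k' (lt_of_lt_of_le hk' ((numVars_pderiv_le k D).trans hD))
  · obtain ⟨i, j, rfl⟩ := exists_window_index₅ k hkW
    rw [hL]
    exact quadTerm_pencil_window_eq_eval_field₅ τ α₀ τ' σ hτ hα₀ hτ' hσ β (field5 β) rfl point5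
      point5_window point5_below point5_above point5_sqrt S i j

end Pencil5

/-! ### Window `kLo = -2`, `n = 6` with the route definitions `point6` / `field6` -/

/-- `point6 S` reads the window at `4j+i`. [this file] -/
theorem point6_window (S : Fin 4 → ℤ → ℝ) (i : Fin 4) (j : Fin 6) :
    point6 S (4 * (j : ℕ) + (i : ℕ)) = S i ((-2 : ℤ) + (j : ℕ)) := by
  fin_cases i <;> fin_cases j <;> rfl

/-- `point6 S` reads the boundary shell `-3` at `24+i`. [this file] -/
theorem point6_below (S : Fin 4 → ℤ → ℝ) (i : Fin 4) : point6 S (24 + (i : ℕ)) = S i (-3) := by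
  fin_cases i <;> rfl

/-- `point6 S` reads the boundary shell `4` at `28+i`. [this file] -/
theorem point6_above (S : Fin 4 → ℤ → ℝ) (i : Fin 4) : point6 S (28 + (i : ℕ)) = S i (4) := by
  fin_cases i <;> rfl

/-- `point6 S 32 = √2`. [this file] -/
theorem point6_sqrt (S : Fin 4 → ℤ → ℝ) : point6 S 32 = Real.sqrt 2 := rfl

/-- **Window/point agreement**: a polynomial in the window variables (`numVars ≤ 24`) has the same value
at the window coordinates `L (win S)` and at `point6 S`. [folklore] -/
theorem eval_window_eq_eval_point6 (Q : Poly) (hQ : numVars Q ≤ 24)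
    (L : (Fin 4 → Fin 6 → ℝ) →L[ℝ] (ℕ → ℝ))
    (hL : ∀ (x : Fin 4 → Fin 6 → ℝ) (i : Fin 4) (j : Fin 6), L x (4 * (j : ℕ) + (i : ℕ)) = x i j)
    (S : Fin 4 → ℤ → ℝ) :
    (Poly.eval (L (fun i (j : Fin 6) => S i ((-2 : ℤ) + ((j : ℕ) : ℤ)))) Q : ℝ) = Poly.eval (point6 S) Q := by
  refine eval_congr Q fun k hk => ?_
  obtain ⟨i, j, rfl⟩ := exists_window_index₆ k (lt_of_lt_of_le hk hQ)
  rw [hL, point6_window]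

section Pencil6

variable (τ α₀ τ' σ : Fin 4 → Fin 4 → Fin 4 → ℤ × ℤ × ℤ → ℝ)
  (hτ : τ = fun (a b c : Fin 4) (μ : ℤ × ℤ × ℤ) => if a = 0 ∧ b = 1 ∧ c = 1 then
    (if μ = (0, 0, 0) then (1 : ℝ) / 2 else if μ = (1, 0, 0) then -(1 / 2) else 0) else 0)
  (hα₀ : α₀ = fun (a b c : Fin 4) (μ : ℤ × ℤ × ℤ) => τ a b c μ - τ c b a (μ.2.2, μ.2.1, μ.1) +
    τ b a c (μ.2.1, μ.1, μ.2.2) - τ c a b (μ.2.2, μ.1, μ.2.1))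
  (hτ' : τ' = fun (a b c : Fin 4) (μ : ℤ × ℤ × ℤ) => if a = 0 ∧ b = 1 ∧ c = 1 then
    (if μ = (0, 0, 1) then (1 : ℝ) / 2 else 0) else 0)
  (hσ : σ = fun (a b c : Fin 4) (μ : ℤ × ℤ × ℤ) => τ' a b c μ - τ' c b a (μ.2.2, μ.2.1, μ.1) +
    τ' b a c (μ.2.1, μ.1, μ.2.2) - τ' c a b (μ.2.2, μ.1, μ.2.1))

include hτ hα₀ hτ' hσ

/-- **General dynamic-clause adapter (window `kLo = -2`, `n = 6`).** For ANY sparse rational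
polynomial `D` in the window variables (the clock `w`, the tube `h`, the collar clock `w + C·h²`, …)
and ANY premise `Prem` on evaluation points: if `(lieDeriv (field6 β) D)(y) ≤ m` holds at every
point `y` with `y_32² = 2`, `y_32 ≥ 0`, `Prem y`, the window caps and the boundary caps — the shape
of an `sdp2lean` certificate whose side conditions encode `Prem` — then for every lattice state `S`
whose point satisfies `Prem` and whose coordinates obey the caps, the Fréchet derivative of
`x ↦ D.eval (L x)` at the window state, applied to the window restriction of the pencil's
`quadTerm`, is `≤ m`. Specialises to `hdec_in`, `hdec_col`, `hinflow` of
`WindowBox.taoLadderRungThree_target_of_twoFunctionCertificate₃` (move premises between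
`L (win S)` and `point6 S` with `eval_window_eq_eval_point6`).
[cite: RoucheHabetsLaloy1977, Ch. I §3.1 eq. (3.1); Tao2016AveragedNS §4 (4.8)] -/
theorem lie_box_of_sos6 (β : ℚ) (D : Poly) (hD : numVars D ≤ 24) (Prem : (ℕ → ℝ) → Prop)
    (L : (Fin 4 → Fin 6 → ℝ) →L[ℝ] (ℕ → ℝ))
    (hL : ∀ (x : Fin 4 → Fin 6 → ℝ) (i : Fin 4) (j : Fin 6), L x (4 * (j : ℕ) + (i : ℕ)) = x i j)
    {q : ℤ → ℝ} {Φ : Fin 4 → Fin 6 → ℝ} {m : ℝ}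
    (hsos : ∀ y : ℕ → ℝ, y 32 * y 32 = 2 → 0 ≤ y 32 → Prem y →
      (∀ (i : Fin 4) (j : Fin 6), y (4 * (j : ℕ) + (i : ℕ)) ^ 2 ≤ 2 * Φ i j) →
      (∀ i : Fin 4, |y (24 + (i : ℕ))| ≤ q (-3)) → (∀ i : Fin 4, |y (28 + (i : ℕ))| ≤ q (4)) →
      (Poly.eval y (lieDeriv (field6 β) D) : ℝ) ≤ m) :
    ∀ S : Fin 4 → ℤ → ℝ, Prem (point6 S) →
      (∀ (i : Fin 4) (k : ℤ), (k < (-2 : ℤ) ∨ (-2 : ℤ) + ((6 : ℕ) : ℤ) ≤ k) → |S i k| ≤ q k) →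
      (∀ (i : Fin 4) (j : Fin 6), S i ((-2 : ℤ) + ((j : ℕ) : ℤ)) ^ 2 ≤ 2 * Φ i j) →
      (fderiv ℝ (fun x : Fin 4 → Fin 6 → ℝ => (Poly.eval (L x) D : ℝ)) (fun i (j : Fin 6) => S i ((-2 : ℤ) + ((j : ℕ) : ℤ))))
        (fun i (j : Fin 6) => quadTerm 1 (fun a b c μ => α₀ a b c μ + (β : ℝ) * σ a b c μ)
          (fun i' k' (_ : ℝ) => S i' k') i ((-2 : ℤ) + ((j : ℕ) : ℤ)) 0) ≤ m := by
  intro S hPrem hout hcap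
  have hy : ∀ k < 24, L (fun i (j : Fin 6) => S i ((-2 : ℤ) + ((j : ℕ) : ℤ))) k = point6 S k := by
    intro k hk
    obtain ⟨i, j, rfl⟩ := exists_window_index₆ k hk
    rw [hL, point6_window]
  have key := hsos (point6 S) (by rw [point6_sqrt]; exact Real.mul_self_sqrt zero_le_two)
    (by rw [point6_sqrt]; exact Real.sqrt_nonneg 2) hPrem
    (fun i j => by rw [point6_window]; exact hcap i j)
    (fun i => by rw [point6_below]; exact hout i (-3) (Or.inl (by norm_num)))
    (fun i => by rw [point6_above]; exact hout i (4) (Or.inr (by norm_num)))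
  rw [eval_lieDeriv] at key
  rw [SOSPolyCalculus.fderiv_eval_comp_apply]
  refine le_of_eq_of_le (Finset.sum_congr rfl fun k hk => ?_) key
  have hk : k < numVars D := by simpa using hk
  have hkW : k < 24 := lt_of_lt_of_le hk hD
  congr 1
  · exact eval_congr _ fun k' hk' => hy k' (lt_of_lt_of_le hk' ((numVars_pderiv_le k D).trans hD))
  · obtain ⟨i, j, rfl⟩ := exists_window_index₆ k hkW
    rw [hL]
    exact quadTerm_pencil_window_eq_eval_field₆ τ α₀ τ' σ hτ hα₀ hτ' hσ β (field6 β) rfl point6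
      point6_window point6_below point6_above point6_sqrt S i j

end Pencil6

end TriggerWindow

end Summit.NavierStokesRegularity.NavierStokesRegularity.Theorems
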